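import Literature.NumberTheory.Sieve.BombieriAsymptoticSieveDimension
import HarnessLib

/-!
# Bombieri's asymptotic sieve: Lemma 11 of Friedlander–Iwaniec (the tail `Σ₂`) from the fundamental lemma

Topic `Literature/NumberTheory/Sieve`, companion ("Proofs") file of `BombieriAsymptoticSieve.lean`
([BombieriRIMS1977]; [FriedlanderIwaniecPisa1978] §4). Source: J. Friedlander, H. Iwaniec,
*On Bombieri's asymptotic sieve*, Ann. Scuola Norm. Sup. Pisa Cl. Sci. (4) **5** (1978) 719–756,
Lemma 11 (p. 738), scalar case `(k)`, `K = ℚ`.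

Main result: `BombieriSieve.FI1978_lemma11_of_fundamentalLemma :
SieveSequence.fundamental_lemma_uniform → FI1978_lemma11` — the named fact `FI1978_lemma11` of
`BombieriAsymptoticSieve.lean` is reduced to the fundamental lemma of sieve theory
(`SieveSequence.fundamental_lemma_uniform` of `SieveFramework.lean`, Halberstam–Richert Thm 2.5,
which is Friedlander–Iwaniec's "Lemma 5"), everything else being proved here and in
`BombieriAsymptoticSieveLemmata.lean` / `BombieriAsymptoticSieveDimension.lean`:

* `abs_truncLambdaUpper_le`, `abs_sigma2_le` — the first display of the printed proof:
  `|Σ₂| ≤ (log x/y)^k ∑_{m ≤ x/y, (m,P(z))=1} S(𝒜_m, z; x)`;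
* `FI1978_lemma11_of_fundamentalLemma` — the upper-bound sieve (fundamental lemma at level `z²`)
  for each `𝒜_m`, (A₂) for the distinct moduli `νm ≤ z² x/y < x^{1−ε}`, Lemma 7 (`V(z) ≪ 1/log z`)
  and Lemma 8 (`∑ g(m) ≪ log(x/y)/log z`).
-/

noncomputable section

open Filter Finset
open scoped Topology

namespace Literature.NumberTheory.Sieve

namespace BombieriSieve

open scoped ArithmeticFunction.Moebius

/-! ### [FriedlanderIwaniecPisa1978] Lemma 11: reduction of `Σ₂` to sifted subsequence sums -/

/-- For `n ≤ x` and `0 < y ≤ x`: `|∑_{d ∣ n, d ≥ y} μ(d)(log n/d)^k| ≤ (log x/y)^k · #{m ∣ n : m ≤ x/y}`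
(write `m = n/d ≤ x/y`, so `0 ≤ log m ≤ log x/y`, and `d ↦ m` is injective; the first display in
the proof of [FriedlanderIwaniecPisa1978] Lemma 11, scalar case `|k'| = 0`, `a = k`).
[cite: FriedlanderIwaniecPisa1978, Lemma 11 (proof)] -/
theorem abs_truncLambdaUpper_le (k : ℕ) {x y : ℝ} (hy : 0 < y) (hyx : y ≤ x) {n : ℕ}
    (hnx : (n : ℝ) ≤ x) :
    |truncLambdaUpper k y n| ≤
      Real.log (x / y) ^ k * #(n.divisors.filter (fun m : ℕ => (m : ℝ) ≤ x / y)) := by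
  have hlog0 : 0 ≤ Real.log (x / y) := Real.log_nonneg ((one_le_div hy).mpr hyx)
  set T := n.divisorsAntidiagonal.filter (fun e : ℕ × ℕ => y ≤ ((e.1 : ℕ) : ℝ)) with hT
  -- for `(d, m) ∈ T`: `m ∣ n`, `1 ≤ m ≤ x / y`
  have hmem : ∀ e ∈ T, e.2 ∈ n.divisors.filter (fun m : ℕ => (m : ℝ) ≤ x / y) ∧ 1 ≤ e.2 := by
    intro e he
    obtain ⟨he', hye⟩ := Finset.mem_filter.mp he
    obtain ⟨hprod, hn⟩ := Nat.mem_divisorsAntidiagonal.mp he'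
    have he2 : e.2 ≠ 0 := fun h => hn (by rw [← hprod, h, mul_zero])
    have he1 : e.1 ≠ 0 := fun h => hn (by rw [← hprod, h, zero_mul])
    have he1pos : (0 : ℝ) < e.1 := by exact_mod_cast Nat.pos_of_ne_zero he1
    refine ⟨Finset.mem_filter.mpr ⟨Nat.mem_divisors.mpr ⟨⟨e.1, by rw [mul_comm, hprod]⟩, hn⟩, ?_⟩,
      Nat.one_le_iff_ne_zero.mpr he2⟩
    have h2 : (e.2 : ℝ) = n / e.1 := by
      rw [eq_div_iff he1pos.ne', ← Nat.cast_mul, mul_comm, hprod]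
    rw [h2, div_le_div_iff₀ he1pos hy]
    have hx0 : 0 ≤ x := hy.le.trans hyx
    calc (n : ℝ) * y ≤ x * y := mul_le_mul_of_nonneg_right hnx hy.le
      _ ≤ x * e.1 := mul_le_mul_of_nonneg_left hye hx0
  -- termwise bound
  have hbound : ∀ e ∈ T, |(μ e.1 : ℝ) * Real.log e.2 ^ k| ≤ Real.log (x / y) ^ k := by
    intro e he
    obtain ⟨hm, h1⟩ := hmem e he
    have hmx : (e.2 : ℝ) ≤ x / y := (Finset.mem_filter.mp hm).2
    have hl0 : 0 ≤ Real.log e.2 := Real.log_natCast_nonneg _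
    have hl : Real.log e.2 ≤ Real.log (x / y) := Real.log_le_log (by exact_mod_cast h1) hmx
    have hμ : |(μ e.1 : ℝ)| ≤ 1 := by
      rw [← Int.cast_abs]
      exact_mod_cast ArithmeticFunction.abs_moebius_le_one
    rw [abs_mul, abs_of_nonneg (pow_nonneg hl0 _)]
    calc |(μ e.1 : ℝ)| * Real.log e.2 ^ k ≤ 1 * Real.log (x / y) ^ k :=
          mul_le_mul hμ (pow_le_pow_left₀ hl0 hl _) (pow_nonneg hl0 _) zero_le_one
      _ = Real.log (x / y) ^ k := one_mul _
  -- counting: `(d, m) ↦ m` is injective on `T`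
  have hcard : #T ≤ #(n.divisors.filter (fun m : ℕ => (m : ℝ) ≤ x / y)) := by
    refine Finset.card_le_card_of_injOn Prod.snd (fun e he => (hmem e he).1) ?_
    intro e he e' he' h
    obtain ⟨hprod, hn⟩ := Nat.mem_divisorsAntidiagonal.mp (Finset.mem_filter.mp he).1
    obtain ⟨hprod', -⟩ := Nat.mem_divisorsAntidiagonal.mp (Finset.mem_filter.mp he').1
    have h2 : e.2 ≠ 0 := fun h0 => hn (by rw [← hprod, h0, mul_zero])
    change e.2 = e'.2 at h
    have h1 : e.1 = e'.1 := by
      apply Nat.eq_of_mul_eq_mul_right (Nat.pos_of_ne_zero h2)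
      rw [hprod, h, hprod']
    exact Prod.ext h1 h
  rw [truncLambdaUpper]
  refine (Finset.abs_sum_le_sum_abs _ _).trans ?_
  refine (Finset.sum_le_sum hbound).trans ?_
  rw [Finset.sum_const, nsmul_eq_mul, mul_comm]
  exact mul_le_mul_of_nonneg_left (by exact_mod_cast hcard) (pow_nonneg hlog0 _)

/-- **`Σ₂` against the sifted subsequences** (proof of [FriedlanderIwaniecPisa1978] Lemma 11, first
step, scalar case): for `0 < y ≤ x`,
`|Σ₂| ≤ (log x/y)^k ∑_{m ≤ x/y, (m, P(z)) = 1} S(𝒜_m, z; x)`, where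
`S(𝒜_m, z; x) = ∑_{n ≤ x, (n, P(z)) = 1, m ∣ n} a_n` (`sifted_restrictDvd`): bound each
`|∑_{d ∣ n, d ≥ y} μ(d)(log n/d)^k|` by `(log x/y)^k #{m ∣ n : m ≤ x/y}` and interchange; a divisor of
an integer coprime to `P(z)` is coprime to `P(z)`. [cite: FriedlanderIwaniecPisa1978, Lemma 11 (proof)] -/
theorem abs_sigma2_le (A : SieveSequence) (k : ℕ) {x y : ℝ} (z : ℝ) (hy : 0 < y) (hyx : y ≤ x) :
    |sigma2 A k x y z| ≤ Real.log (x / y) ^ k *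
      ∑ m ∈ (Ioc 0 ⌊x / y⌋₊).filter (fun m : ℕ => m.Coprime (primesProdBelow z)),
        (A.restrictDvd m).sifted x (primesProdBelow z) := by
  have hx0 : 0 ≤ x := hy.le.trans hyx
  have hxy0 : 0 ≤ x / y := div_nonneg hx0 hy.le
  have hlog0 : 0 ≤ Real.log (x / y) := Real.log_nonneg ((one_le_div hy).mpr hyx)
  set P := primesProdBelow z with hP
  set N := ⌊x⌋₊ with hN
  set D := ⌊x / y⌋₊ with hD
  -- the weight `1_{(n,P)=1} a_n`
  set a' : ℕ → ℝ := fun n => if n.Coprime P then A.a n else 0 with ha'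
  have ha'0 : ∀ n, 0 ≤ a' n := fun n => by
    simp only [ha']
    split_ifs
    exacts [A.a_nonneg n, le_rfl]
  -- Step 1: termwise
  have hstep1 : |sigma2 A k x y z| ≤ Real.log (x / y) ^ k *
      ∑ n ∈ Ioc 0 N, a' n * ∑ m ∈ n.divisors with m ≤ D, (1 : ℝ) := by
    rw [sigma2, ← hP, ← hN, Finset.mul_sum]
    refine (Finset.abs_sum_le_sum_abs _ _).trans ?_
    rw [← Finset.sum_filter_add_sum_filter_not (Ioc 0 N) (fun n : ℕ => n.Coprime P)
      (fun n => Real.log (x / y) ^ k * (a' n * ∑ m ∈ n.divisors with m ≤ D, (1 : ℝ)))]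
    have hzero : ∑ n ∈ (Ioc 0 N).filter (fun n : ℕ => ¬ n.Coprime P),
        Real.log (x / y) ^ k * (a' n * ∑ m ∈ n.divisors with m ≤ D, (1 : ℝ)) = 0 := by
      refine Finset.sum_eq_zero fun n hn => ?_
      rw [ha']
      simp only
      rw [if_neg (Finset.mem_filter.mp hn).2, zero_mul, mul_zero]
    rw [hzero, add_zero]
    refine Finset.sum_le_sum fun n hn => ?_
    obtain ⟨hn', hcop⟩ := Finset.mem_filter.mp hn
    have hnx : (n : ℝ) ≤ x := le_trans (by exact_mod_cast (Finset.mem_Ioc.mp hn').2) (Nat.floor_le hx0)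
    rw [abs_mul, abs_of_nonneg (A.a_nonneg n), ha']
    simp only
    rw [if_pos hcop]
    have hcard : ((#(n.divisors.filter (fun m : ℕ => (m : ℝ) ≤ x / y)) : ℕ) : ℝ) =
        ∑ m ∈ n.divisors with m ≤ D, (1 : ℝ) := by
      rw [Finset.sum_const, nsmul_eq_mul, mul_one]
      congr 2
      ext m
      simp only [Finset.mem_filter, hD]
      exact and_congr_right fun _ => (Nat.le_floor_iff hxy0).symm
    calc |truncLambdaUpper k y n| * A.a n
        ≤ (Real.log (x / y) ^ k * #(n.divisors.filter (fun m : ℕ => (m : ℝ) ≤ x / y))) * A.a n :=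
          mul_le_mul_of_nonneg_right (abs_truncLambdaUpper_le k hy hyx hnx) (A.a_nonneg n)
      _ = Real.log (x / y) ^ k * (A.a n * ∑ m ∈ n.divisors with m ≤ D, (1 : ℝ)) := by
          rw [← hcard]
          ring
  refine hstep1.trans (mul_le_mul_of_nonneg_left (le_of_eq ?_) (pow_nonneg hlog0 _))
  -- Step 2: interchange
  rw [sum_mul_sum_divisors_le_eq a' (fun _ => (1 : ℝ)) N D]
  simp only [one_mul]
  -- Step 3: inner sums are the sifted subsequence sums; outer sum restricts to `(m, P) = 1`
  have hinner : ∀ m : ℕ, ∑ n ∈ (Ioc 0 N).filter (m ∣ ·), a' n = (A.restrictDvd m).sifted x P := by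
    intro m
    rw [sifted_restrictDvd, ← hN, ha', Finset.sum_filter, Finset.sum_filter]
    refine Finset.sum_congr rfl fun n _ => ?_
    by_cases hmn : m ∣ n
    · by_cases hc : n.Coprime P
      · rw [if_pos hmn, if_pos hc, if_pos ⟨hc, hmn⟩]
      · rw [if_pos hmn, if_neg hc, if_neg (fun h => hc h.1)]
    · rw [if_neg hmn, if_neg (fun h => hmn h.2)]
  simp_rw [hinner]
  symm
  refine Finset.sum_subset (Finset.filter_subset _ _) fun m hm hmnot => ?_
  -- `m` not coprime to `P`: no `n` coprime to `P` is divisible by `m`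
  have hmc : ¬ m.Coprime P := fun h => hmnot (Finset.mem_filter.mpr ⟨hm, h⟩)
  rw [sifted_restrictDvd]
  refine Finset.sum_eq_zero fun n hn => ?_
  obtain ⟨-, hc, hmn⟩ := Finset.mem_filter.mp hn
  exact absurd (Nat.Coprime.coprime_dvd_left hmn hc) hmc

end BombieriSieve

end Literature.NumberTheory.Sieve

namespace Literature.NumberTheory.Sieve

namespace BombieriSieve

/-! ### [FriedlanderIwaniecPisa1978] Lemma 11 from the fundamental lemma -/

/-- **[FriedlanderIwaniecPisa1978] Lemma 11, proved from the fundamental lemma of sieve theory**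
(`SieveSequence.fundamental_lemma_uniform`, Halberstam–Richert Thm 2.5 = FI's "Lemma 5", kept as
the hypothesis `hFL`). The printed proof (p. 738), scalar case `|k'| = 0`, `a = k`: for `d ≥ y`,
`|μ(d)| (log n/d)^k ≤ (log x/y)^k`, so
`|Σ₂| ≤ (log x/y)^k ∑_{d < x/y, (d,P(z))=1} ∑_{n ≤ x, (n,P(z))=1, d ∣ n} a_n` (`abs_sigma2_le`);
"By Lemma 5 we get `∑_{n ≤ x, (n,P(z))=1, n ≡ 0 (mod d)} a_n ≪ A(x) f(d)⁻¹ ∏_{p∣P(z)}(1 − 1/f(p)) +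
∑_{ν∣P(z), ν ≤ z²} |R(x, νd)|`" — here the upper half of the fundamental lemma for the subsequence
`𝒜_d` (`SieveSequence.restrictDvd`; size `g(d)A(x)`, same density, remainders `R(x; νd)` by
`remainder_restrictDvd`; dimension `1` by `hasSieveDimension`) at level `z²`; then (A₂) for the
distinct moduli `νd ≤ z² x/y < x^{1−ε}` (`sum_coprime_sum_divisors_le`), Lemma 7
(`V(z) ≪ 1/log z`, `FI1978_lemma7_rat`) and Lemma 8 (`∑_{d<x/y,(d,P(z))=1} g(d) ≪ log(x/y)/log z`,
`FI1978_lemma8_rat`). The (A₂)-term `C(ε) A(x)(log x)^{k−3}` is below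
`A(x)(log x/y)^{k+1}(log z)^{−2}` once `log x ≥ C(ε)`, which is where the threshold `x₀(ε)`
enters; the constant is `(1 + C_FL) C₇ C₈ + 1`, independent of `ε`. In the degenerate case
`A ≡ 0` of `density_nonneg_or_size_eq_zero`, `Σ₂ = 0`.
[cite: FriedlanderIwaniecPisa1978, Lemma 11] -/
theorem FI1978_lemma11_of_fundamentalLemma (hFL : SieveSequence.fundamental_lemma_uniform) :
    FI1978_lemma11 := by
  intro A hA k hk
  have hsize := hA.1
  have hA0 : ∀ x, 0 ≤ A.size x := SieveSequence.size_nonneg_of_size_eq hsize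
  rcases density_nonneg_or_size_eq_zero A hA with hg | hzero
  swap
  · -- degenerate case: all `a_n` vanish, `Σ₂ = 0`
    refine ⟨0, fun ε hε => Filter.Eventually.of_forall fun x y z _ _ _ _ => ?_⟩
    have h0 : ∑ n ∈ Ioc 0 ⌊x⌋₊, A.a n = 0 := by
      have := hzero x
      rwa [hsize x, SieveSequence.congrSum,
        Finset.filter_true_of_mem (fun n _ => one_dvd n)] at this
    have ha : ∀ n ∈ Ioc 0 ⌊x⌋₊, A.a n = 0 :=
      (Finset.sum_eq_zero_iff_of_nonneg fun n _ => A.a_nonneg n).mp h0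
    have hs : sigma2 A k x y z = 0 := by
      rw [sigma2]
      exact Finset.sum_eq_zero fun n hn => by rw [ha n (Finset.mem_filter.mp hn).1, mul_zero]
    rw [hs, abs_zero]
    simp
  -- the constants: sieve dimension, fundamental lemma, Lemma 7, Lemma 8
  obtain ⟨K, hK⟩ := hasSieveDimension A hA hg
  obtain ⟨CF, hCF0, hFL'⟩ := hFL 1 K
  obtain ⟨H, -, -, η, -, C₇, h7⟩ := FI1978_lemma7_rat A hA
  obtain ⟨C₈, h8⟩ := FI1978_lemma8_rat A hA.2.1 hA.2.2.2.2.2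
  set C₇' := max C₇ 1 with hC₇'
  set C₈' := max C₈ 1 with hC₈'
  have hC₇'0 : 0 ≤ C₇' := zero_le_one.trans (le_max_right _ _)
  have hC₈'0 : 0 ≤ C₈' := zero_le_one.trans (le_max_right _ _)
  refine ⟨(1 + CF) * C₇' * C₈' + 1, fun ε hε => ?_⟩
  -- (A₂) with this `ε` and `B = 3`
  obtain ⟨C₂, hC₂⟩ := hA.2.2.1 ε hε ((3 : ℕ) : ℝ) (by norm_num)
  filter_upwards [hC₂, eventually_ge_atTop (1 : ℝ),
    Real.tendsto_log_atTop.eventually_ge_atTop (max 1 C₂)] with x hx2 hx1 hxlog y z hz hzy hzx hyx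
  -- the parameters
  have hx0 : 0 < x := by linarith
  have hlogx1 : 1 ≤ Real.log x := (le_max_left _ _).trans hxlog
  have hC₂log : C₂ ≤ Real.log x := (le_max_right _ _).trans hxlog
  have hz0 : 0 < z := by linarith
  have hz1 : 1 < z := by linarith
  have hsqrt1 : 1 ≤ Real.sqrt x := by
    rw [← Real.sqrt_one]
    exact Real.sqrt_le_sqrt hx1
  have hsqrt0 : 0 < Real.sqrt x := by linarith
  have hy2 : 2 ≤ y := by nlinarith
  have hy0 : 0 < y := by linarith
  have hy1 : 1 ≤ y := by linarith
  have hyx' : y ≤ x := by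
    refine hyx.le.trans ?_
    calc x ^ (1 - ε) ≤ x ^ (1 : ℝ) := Real.rpow_le_rpow_of_exponent_le hx1 (by linarith)
      _ = x := Real.rpow_one x
  have hzxy : z < x / y := by rwa [lt_div_iff₀ hy0]
  have hxy0 : 0 ≤ x / y := div_nonneg hx0.le hy0.le
  have hzx' : z ≤ x := hzxy.le.trans (div_le_self hx0.le hy1)
  have hlogz : 0 < Real.log z := Real.log_pos hz1
  have hlogxy : Real.log z ≤ Real.log (x / y) := Real.log_le_log hz0 hzxy.le
  have hlogxy0 : 0 < Real.log (x / y) := hlogz.trans_le hlogxy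
  have hlogzx : Real.log z ≤ Real.log x := Real.log_le_log hz0 hzx'
  -- the level: `z² · x/y < z √x < y < x^{1−ε}`
  have hlevel : x / y * z ^ 2 < x ^ (1 - ε) := by
    have h1 : x / y * z ^ 2 < z * Real.sqrt x := by
      rw [div_mul_eq_mul_div, div_lt_iff₀ hy0]
      have hsx : Real.sqrt x ^ 2 = x := Real.sq_sqrt hx0.le
      have h2 : Real.sqrt x * z < y := by linarith
      calc x * z ^ 2 = (Real.sqrt x * z) * (z * Real.sqrt x) := by
            linear_combination (-(z ^ 2)) * hsx
        _ < y * (z * Real.sqrt x) := mul_lt_mul_of_pos_right h2 (mul_pos hz0 hsqrt0)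
        _ = z * Real.sqrt x * y := by ring
    exact h1.trans (hzx.trans hyx)
  set P := primesProdBelow z with hP
  set V := A.densityProduct P with hV
  have hVle : V ≤ C₇' / Real.log z :=
    (h7 z hz).2.trans (div_le_div_of_nonneg_right (le_max_left _ _) hlogz.le)
  have hV0 : 0 ≤ V := by
    rw [hV, densityProduct_primesProdBelow]
    exact Finset.prod_nonneg fun p hp =>
      (sub_pos.mpr (hA.2.1.2 p (Nat.prime_of_mem_primesBelow hp).one_lt)).le
  have hAx := hA0 x
  -- Step 1: `|Σ₂| ≤ (log x/y)^k ∑_m S(𝒜_m, z; x)`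
  have h1 := abs_sigma2_le A k z hy0 hyx'
  rw [← hP] at h1
  -- Step 2: the fundamental lemma (upper half) for each `𝒜_m`, `(m, P(z)) = 1`, at level `z²`
  have hFLm : ∀ m ∈ (Ioc 0 ⌊x / y⌋₊).filter (fun m : ℕ => m.Coprime P),
      (A.restrictDvd m).sifted x P ≤ (1 + CF) * A.size x * V * |A.density m| +
        ∑ d ∈ P.divisors.filter (fun d : ℕ => (d : ℝ) ≤ z ^ 2), |A.remainder (m * d) x| := by
    intro m hm
    obtain ⟨hm', hmP⟩ := Finset.mem_filter.mp hm
    have hm1 : 1 ≤ m := (Finset.mem_Ioc.mp hm').1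
    have hgm : 0 ≤ A.density m := hg m hm1
    have hsz : 0 ≤ A.density m * A.size x := mul_nonneg hgm hAx
    have hzz : z ≤ z ^ 2 := by nlinarith
    have h : |(A.restrictDvd m).sifted x P - A.density m * A.size x * V| ≤
        CF * (A.density m * A.size x) * V * Real.exp (-(Real.log (z ^ 2) / Real.log z)) +
          ∑ d ∈ P.divisors.filter (fun d : ℕ => (d : ℝ) ≤ z ^ 2),
            |(A.restrictDvd m).remainder d x| :=
      hFL' (A.restrictDvd m) hK x z (z ^ 2) hz hzz hsz
    have hrem : ∑ d ∈ P.divisors.filter (fun d : ℕ => (d : ℝ) ≤ z ^ 2),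
        |(A.restrictDvd m).remainder d x| =
        ∑ d ∈ P.divisors.filter (fun d : ℕ => (d : ℝ) ≤ z ^ 2), |A.remainder (m * d) x| := by
      refine Finset.sum_congr rfl fun d hd => ?_
      have hdP : d ∣ P := Nat.dvd_of_mem_divisors (Finset.mem_filter.mp hd).1
      rw [remainder_restrictDvd A (hmP.coprime_dvd_right hdP)]
    rw [hrem] at h
    have hexp : Real.exp (-(Real.log (z ^ 2) / Real.log z)) ≤ 1 := by
      rw [Real.exp_le_one_iff, neg_nonpos]
      exact div_nonneg (Real.log_nonneg (by nlinarith)) hlogz.le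
    have hup := (abs_sub_le_iff.mp h).1
    have hgAV : 0 ≤ CF * (A.density m * A.size x) * V := mul_nonneg (mul_nonneg hCF0.le hsz) hV0
    have hmain : A.density m * A.size x * V +
        CF * (A.density m * A.size x) * V * Real.exp (-(Real.log (z ^ 2) / Real.log z)) ≤
        (1 + CF) * A.size x * V * |A.density m| := by
      rw [abs_of_nonneg hgm]
      calc A.density m * A.size x * V +
            CF * (A.density m * A.size x) * V * Real.exp (-(Real.log (z ^ 2) / Real.log z))
          ≤ A.density m * A.size x * V + CF * (A.density m * A.size x) * V * 1 := by
            gcongr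
        _ = (1 + CF) * A.size x * V * A.density m := by ring
    linarith
  -- Step 3: summing over `m`: Lemma 8 for the main terms, rearrangement + (A₂) for the remainders
  have h8' : ∑ m ∈ (Ioc 0 ⌊x / y⌋₊).filter (fun m : ℕ => m.Coprime P), |A.density m| ≤
      C₈' * Real.log (x / y) / Real.log z := by
    refine (h8 (x / y) z hz hzxy.le).trans ?_
    exact div_le_div_of_nonneg_right (mul_le_mul_of_nonneg_right (le_max_left _ _) hlogxy0.le)
      hlogz.le
  have hR : ∑ m ∈ (Ioc 0 ⌊x / y⌋₊).filter (fun m : ℕ => m.Coprime P),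
      ∑ d ∈ P.divisors.filter (fun d : ℕ => (d : ℝ) ≤ z ^ 2), |A.remainder (m * d) x| ≤
      C₂ * A.size x / Real.log x ^ 3 := by
    have hM : ∀ m ∈ (Ioc 0 ⌊x / y⌋₊).filter (fun m : ℕ => m.Coprime P), m ≠ 0 ∧ m.Coprime P :=
      fun m hm => ⟨(Finset.mem_Ioc.mp (Finset.mem_filter.mp hm).1).1.ne',
        (Finset.mem_filter.mp hm).2⟩
    have hL : ∀ m ∈ (Ioc 0 ⌊x / y⌋₊).filter (fun m : ℕ => m.Coprime P),
        (m : ℝ) * z ^ 2 < x ^ (1 - ε) := by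
      intro m hm
      have hmX : (m : ℝ) ≤ x / y :=
        (Nat.cast_le.mpr (Finset.mem_Ioc.mp (Finset.mem_filter.mp hm).1).2).trans
          (Nat.floor_le hxy0)
      exact (mul_le_mul_of_nonneg_right hmX (sq_nonneg z)).trans_lt hlevel
    have hre := sum_coprime_sum_divisors_le (primesProdBelow_ne_zero z)
      (fun q => |A.remainder q x|) (fun q => abs_nonneg _) _ hM (z ^ 2) (x ^ (1 - ε)) hL
    refine hre.trans ?_
    have := hx2 (fun _ => x) fun _ => le_rfl
    rwa [Real.rpow_natCast] at this
  have hsumS : ∑ m ∈ (Ioc 0 ⌊x / y⌋₊).filter (fun m : ℕ => m.Coprime P),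
      (A.restrictDvd m).sifted x P ≤
      (1 + CF) * A.size x * V * (C₈' * Real.log (x / y) / Real.log z) +
        C₂ * A.size x / Real.log x ^ 3 := by
    refine (Finset.sum_le_sum hFLm).trans ?_
    rw [Finset.sum_add_distrib, ← Finset.mul_sum]
    refine add_le_add (mul_le_mul_of_nonneg_left h8' ?_) hR
    exact mul_nonneg (mul_nonneg (by linarith) hAx) hV0
  -- Step 4: arithmetic
  have hT1 : (1 + CF) * A.size x * V * (C₈' * Real.log (x / y) / Real.log z) ≤
      (1 + CF) * C₇' * C₈' * A.size x * Real.log (x / y) / Real.log z ^ 2 := by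
    have hnn : 0 ≤ (1 + CF) * A.size x * (C₈' * Real.log (x / y) / Real.log z) :=
      mul_nonneg (mul_nonneg (by linarith) hAx)
        (div_nonneg (mul_nonneg hC₈'0 hlogxy0.le) hlogz.le)
    calc (1 + CF) * A.size x * V * (C₈' * Real.log (x / y) / Real.log z)
        = (1 + CF) * A.size x * (C₈' * Real.log (x / y) / Real.log z) * V := by ring
      _ ≤ (1 + CF) * A.size x * (C₈' * Real.log (x / y) / Real.log z) * (C₇' / Real.log z) :=
          mul_le_mul_of_nonneg_left hVle hnn
      _ = (1 + CF) * C₇' * C₈' * A.size x * Real.log (x / y) / Real.log z ^ 2 := by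
          field_simp
  have hT2 : C₂ * A.size x / Real.log x ^ 3 ≤ A.size x * Real.log (x / y) / Real.log z ^ 2 := by
    have hlx0 : 0 < Real.log x := by linarith
    have ha : C₂ / Real.log x ^ 3 ≤ 1 / Real.log x := by
      rw [div_le_div_iff₀ (pow_pos hlx0 3) hlx0]
      have : C₂ * Real.log x ≤ Real.log x * Real.log x := mul_le_mul_of_nonneg_right hC₂log hlx0.le
      nlinarith
    have hb : 1 / Real.log x ≤ 1 / Real.log z := one_div_le_one_div_of_le hlogz hlogzx
    have hc : 1 / Real.log z ≤ Real.log (x / y) / Real.log z ^ 2 := by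
      rw [div_le_div_iff₀ hlogz (pow_pos hlogz 2), one_mul, pow_two]
      exact mul_le_mul_of_nonneg_right hlogxy hlogz.le
    calc C₂ * A.size x / Real.log x ^ 3 = A.size x * (C₂ / Real.log x ^ 3) := by ring
      _ ≤ A.size x * (Real.log (x / y) / Real.log z ^ 2) :=
          mul_le_mul_of_nonneg_left (ha.trans (hb.trans hc)) hAx
      _ = A.size x * Real.log (x / y) / Real.log z ^ 2 := by ring
  calc |sigma2 A k x y z|
      ≤ Real.log (x / y) ^ k * ∑ m ∈ (Ioc 0 ⌊x / y⌋₊).filter (fun m : ℕ => m.Coprime P),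
          (A.restrictDvd m).sifted x P := h1
    _ ≤ Real.log (x / y) ^ k * ((1 + CF) * C₇' * C₈' * A.size x * Real.log (x / y) /
          Real.log z ^ 2 + A.size x * Real.log (x / y) / Real.log z ^ 2) :=
        mul_le_mul_of_nonneg_left (hsumS.trans (add_le_add hT1 hT2)) (pow_nonneg hlogxy0.le k)
    _ = ((1 + CF) * C₇' * C₈' + 1) * A.size x * Real.log (x / y) ^ (k + 1) / Real.log z ^ 2 := by
        ring

end BombieriSieve

end Literature.NumberTheory.Sieve
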